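import Summits.NavierStokesRegularity.NavierStokesRegularity.Theses.QuantisedSymmetry
import Summits.NavierStokesRegularity.NavierStokesRegularity.Theorems.QuantisedSymmetryPolyhedralTruncationBridge
import Literature.Analysis.FluidPDE.SelfSimilarLiouville
import Literature.Analysis.FluidPDE.ChaeWolfDSSDecayLtNine
import HarnessLib

/-!
# Strategist s12 (independent census, family `s`) — typed companion to `STRATEGY-CENSUS-s12.md`

Crux: `Theses.QuantisedSymmetry.PolyhedralDssProfileExists` (stmt-NavierStokesRegularity-1404).
This file is sorry-free and records, over existing declarations only:

* `crux_decides_negatively` — the crux ALONE already decides the sub-problem negatively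
  (`closes` with its two other binders discharged by landed theorems), so every admissible
  replacement `X` of the crux in `closes` lies in the interval `[¬ NavierStokesRegularity, C)`;
* `DssTypeIProfileExists` — the "drop the symmetry group" weaker intermediate `W1`, with
  `dssTypeIProfileExists_of_crux : C → W1` and
  `dssTypeIProfileExists_iff_not_liouville : W1 ↔ ¬ ∀ c, TypeIDSSLiouville c`
  (so `W1` is literally the negation of the plain half of the tree's open
  `TypeIDSSLiouvilleConjecture`, i.e. the load-bearing crux of the existing routes
  Blowup / DssFarFieldSlaving — no new leverage);
* `LqSliceUpgrade` / `lqSliceUpgrade_holds` — piece 2 of the typed split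
  "∃ G-equivariant λ-DSS classical ancient solution with slices in `L^q`, `3 ≤ q < 9`" +
  "`L^q`-DSS ⇒ Type I" is ALREADY a tree theorem (Chae–Wolf 2017 Thm 1.1,
  `chaeWolf2017_dss_typeI_decay_of_lt_nine`), so piece 1 carries the whole crux: the split
  fails test (c) of the census;
* `SteadyPolyhedralProfileExists` — the strengthening `S⁺` "λ-continuous (self-similar)
  polyhedral Type-I profile", typed; refuted in print by Tsai 1998 Thm 1 / NRŠ 1996
  (tree: `Literature.Analysis.FluidPDE.tsai_selfsimilar_holds` over `IsLerayProfile`), recorded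
  here as a definition only (the mild-solution ↔ Leray-profile dictionary is not restated).
-/

noncomputable section

open MeasureTheory Set

namespace Summit.NavierStokesRegularity.NavierStokesRegularity.Cruxes.PolyhedralDssProfileExists.S12

open Summit.NavierStokesRegularity.NavierStokesRegularity.Theses.QuantisedSymmetry
open Literature.Analysis.FluidPDE

local notation "E3" => EuclideanSpace ℝ (Fin 3)

/-- **Certificate.** The crux alone refutes the summit statement: `closes` with
`PolyhedralTruncationBridge` (stmt-11331, proved) and `ClayUniqueness` (stmt-0153, proved)
discharged by landed theorems. Hence any `X` with `X → PolyhedralDssProfileExists` usable in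
`closes` satisfies `X → ¬ NavierStokesRegularity`: there is no intermediate strictly between the
crux and the (negated) summit on the hypothesis side. -/
theorem crux_decides_negatively :
    PolyhedralDssProfileExists → ¬ _root_.NavierStokesRegularity := fun hX =>
  closes hX
    _root_.Summit.NavierStokesRegularity.NavierStokesRegularity.Theorems.quantisedSymmetry_polyhedralTruncationBridge_proof
    ClayUniqueness_holds

/-- **W1 (drop the group).** A nontrivial backward `λ`-DSS ancient mild solution with a Type I
bound exists (no symmetry requirement). -/
def DssTypeIProfileExists : Prop :=
  ∃ c : ℝ, 1 < c ∧ ∃ u : ℝ → E3 → E3,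
    IsAncientMildSolution 1 u ∧ (∀ t < 0, AEStronglyMeasurable (u t) volume) ∧
    IsDiscretelySelfSimilar c u ∧ (∃ C₀ : ℝ, HasTypeIDecay C₀ u) ∧ ¬ (∀ t < 0, u t =ᵐ[volume] 0)

/-- `C → W1`: forget the symmetry group. -/
theorem dssTypeIProfileExists_of_crux : PolyhedralDssProfileExists → DssTypeIProfileExists := by
  rintro ⟨_G, _hfin, _hdet, _hirr, c, hc, u, hmild, hmeas, hdss, hTI, _hequiv, hnz⟩
  exact ⟨c, hc, u, hmild, hmeas, hdss, hTI, hnz⟩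

/-- `W1` is exactly the failure of the plain Type I DSS Liouville statement for some factor:
the negation of the first conjunct of the tree's open `TypeIDSSLiouvilleConjecture`, i.e. the
load-bearing existential of routes Blowup / DssFarFieldSlaving (`BlowupTypeIDssProfile`). -/
theorem dssTypeIProfileExists_iff_not_liouville :
    DssTypeIProfileExists ↔ ¬ ∀ c : ℝ, TypeIDSSLiouville c := by
  constructor
  · rintro ⟨c, hc, u, hmild, hmeas, hdss, hTI, hnz⟩ hL
    exact hnz (hL c hc u hmild hmeas hdss hTI)
  · intro h
    by_contra hW
    apply h
    intro c hc u hmild hmeas hdss hTI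
    by_contra hnz
    exact hW ⟨c, hc, u, hmild, hmeas, hdss, hTI, hnz⟩

/-- **Split attempt, piece 2 (`L^q`-slice upgrade).** Every `λ`-DSS classical solution on
`(−∞,0)` with slices continuously in `L^q`, `3 ≤ q < 9`, obeys a Type I bound. -/
def LqSliceUpgrade : Prop :=
  ∀ q : ℝ, 3 ≤ q → q < 9 → ∀ c : ℝ, 1 < c →
    ∀ (u : ℝ → E3 → E3) (p : ℝ → E3 → ℝ), IsClassicalNSSolutionOn (Iio 0) 1 0 u p →
      (∀ t < 0, MemLp (u t) (ENNReal.ofReal q) volume) →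
      (∀ t₀ < 0, Filter.Tendsto (fun t => eLpNorm (u t - u t₀) (ENNReal.ofReal q) volume)
        (nhdsWithin t₀ (Iio 0)) (nhds 0)) →
      IsDiscretelySelfSimilar c u → ∃ C : ℝ, HasTypeIDecay C u

/-- Piece 2 is a tree theorem (Chae–Wolf 2017, Thm 1.1, range `3 ≤ q < 9`): the split
"`L^q`-DSS existence + upgrade" therefore leaves the whole crux in piece 1. -/
theorem lqSliceUpgrade_holds : LqSliceUpgrade := chaeWolf2017_dss_typeI_decay_of_lt_nine

/-- **S⁺ (steady / λ-continuous polyhedral profile).** The strengthening in which the witness is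
self-similar for EVERY factor `c > 1` (a Leray profile) — refuted in print (Nečas–Růžička–Šverák
1996 Thm 1; Tsai 1998 Thm 1, tree `tsai_selfsimilar_holds`), recorded as a typed target only. -/
def SteadyPolyhedralProfileExists : Prop :=
  ∃ G : Subgroup (E3 ≃ₗᵢ[ℝ] E3), Finite G ∧
    (∀ g ∈ G, LinearMap.det (g.toLinearEquiv : E3 →ₗ[ℝ] E3) = 1) ∧
    (∀ V : Submodule ℝ E3, (∀ g ∈ G, ∀ v ∈ V, g v ∈ V) → V = ⊥ ∨ V = ⊤) ∧
    ∃ u : ℝ → E3 → E3, IsAncientMildSolution 1 u ∧ (∀ t < 0, AEStronglyMeasurable (u t) volume) ∧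
      (∀ c : ℝ, 1 < c → IsDiscretelySelfSimilar c u) ∧ (∃ C₀ : ℝ, HasTypeIDecay C₀ u) ∧
      (∀ g ∈ G, ∀ t x, u t (g x) = g (u t x)) ∧ ¬ (∀ t < 0, u t =ᵐ[volume] 0)

/-- `S⁺ → C` (any factor, e.g. `c = 2`). -/
theorem crux_of_steady : SteadyPolyhedralProfileExists → PolyhedralDssProfileExists := by
  rintro ⟨G, hfin, hdet, hirr, u, hmild, hmeas, hss, hTI, hequiv, hnz⟩
  exact ⟨G, hfin, hdet, hirr, 2, by norm_num, u, hmild, hmeas, hss 2 (by norm_num), hTI, hequiv, hnz⟩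

end Summit.NavierStokesRegularity.NavierStokesRegularity.Cruxes.PolyhedralDssProfileExists.S12

end
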